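import Mathlib
import Literature.Computability.AlgebraicComplexity.MatrixMultiplicationExponent
import Literature.Computability.AlgebraicComplexity.GroupAlgebraTensor
import Literature.Computability.AlgebraicComplexity.AsymptoticRankZariskiClosedProofs

/-!
# `FidelityWitnesses.LinearDefectLaw`, line `border-singular-values`: `stub_oneStepGain`

Support file for crux item `stmt-MatrixMultiplication-14039`
(`Summit.MatrixMultiplication.MatrixMultiplication.Theses.FidelityWitnesses.LinearDefectLaw`), line
`border-singular-values`, registered stub `stub_oneStepGain` — the TWO-PLANE BESSEL STEP (the
transport step of the unit-slope telescoping): one more rank-one term buys at least the residual's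
value at a unit triad.

Notation (`T = ⟨n,n,n⟩ = matMulTensor ℂ n n n`, entries `0/1`, hence real):
`⟪A, B⟫ := Σ conj A · B`, `‖A‖² = Σ ‖A abc‖²`, `ov S := Σ S · T` (so `⟪S, T⟫ = conj (ov S)`),
`ns S := Σ ‖S abc‖²`, `fid S := |ov S|² / ns S`, `k := conj (ov S) / ns S`, `E := T − k • S` (the
residual of `T` after projection onto `ℂ • S`), `e := Σ E abc · x a · y b · z c` for unit vectors
`x, y, z`.

* `stub_oneStepGain` — for `S ≠ 0` of rank `≤ r` there is `S'` of rank `≤ r + 1` with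
  `fid S + |e|² ≤ fid S'`.

Proof.  Put `t abc := conj (x a) conj (y b) conj (z c)` (a unit co-triad, `e = ⟪t, E⟫`) and
`S' := k • S + e • t` (rank `≤ r + 1`: `tensorRank_smul_le`, a triad has rank `≤ 1`,
`tensorRank_add_le`).  Entrywise polarisation `‖u − v‖² = ‖u‖² + ‖v‖² − 2 Re (u · conj v)` summed
(`sum_norm_sub_sq`) gives `‖T − S'‖² = ‖E − e t‖² = ‖E‖² − |e|²` and `‖E‖² = ‖T‖² − fid S`; the
junk-safe Bessel bound `‖T‖² − ‖T − W‖² ≤ |⟪W, T⟫|² / ‖W‖²` (`sum_norm_sq_sub_le_div`, AM–GM) at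
`W := S'` then reads `fid S + |e|² ≤ fid S'` (`‖T‖²` cancels).  The algebra is done once over a
single finite index (`two_plane_step_flat`) and transported to the three-slot format by
`Fintype.sum_prod_type` (`oneStepGain_of_conj_eq`); the stub is the case `T = ⟨n,n,n⟩`.
Mathlib only, plus the tree facts `tensorRank_smul_le`, `tensorRank_add_le`,
`tensorRank_le_of_eq_sum`.
-/

set_option linter.dupNamespace false

namespace Summit.MatrixMultiplication.MatrixMultiplication.Theorems.LinearDefectLaw.OneStepGain

open scoped BigOperators ComplexConjugate
open Literature.Computability.AlgebraicComplexity

/-! ## Hermitian bookkeeping on finite complex sums -/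

/-- Polarisation of a difference, summed: `Σ ‖u − v‖² = Σ ‖u‖² + Σ ‖v‖² − 2 Re Σ u · conj v`. -/
theorem sum_norm_sub_sq {ι : Type*} (s : Finset ι) (u v : ι → ℂ) :
    ∑ i ∈ s, ‖u i - v i‖ ^ 2 =
      ∑ i ∈ s, ‖u i‖ ^ 2 + ∑ i ∈ s, ‖v i‖ ^ 2 - 2 * (∑ i ∈ s, u i * conj (v i)).re := by
  simp_rw [Complex.sq_norm]
  rw [Complex.re_sum, Finset.mul_sum, ← Finset.sum_add_distrib, ← Finset.sum_sub_distrib]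
  exact Finset.sum_congr rfl fun i _ => Complex.normSq_sub _ _

/-- Junk-safe Bessel lower bound for the complex line through `W`:
`‖T‖² − ‖T − W‖² ≤ |⟪W, T⟫|² / ‖W‖²` (at `W = 0` both sides vanish; otherwise it is
`2 Re β · ‖W‖² − ‖W‖⁴ ≤ |β|²`, i.e. AM–GM, with `β = ⟪W, T⟫`). -/
theorem sum_norm_sq_sub_le_div {ι : Type*} [Fintype ι] (W T : ι → ℂ) :
    (∑ i, ‖T i‖ ^ 2) - ∑ i, ‖T i - W i‖ ^ 2 ≤
      ‖∑ i, conj (W i) * T i‖ ^ 2 / ∑ i, ‖W i‖ ^ 2 := by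
  rw [sum_norm_sub_sq]
  obtain ⟨β, hβ⟩ : ∃ β : ℂ, (∑ i, T i * conj (W i)) = β := ⟨_, rfl⟩
  obtain ⟨nW, hnW⟩ : ∃ nW : ℝ, (∑ i, ‖W i‖ ^ 2) = nW := ⟨_, rfl⟩
  have hβ' : (∑ i, conj (W i) * T i) = β := by
    rw [← hβ]
    exact Finset.sum_congr rfl fun i _ => mul_comm _ _
  rw [hβ, hnW, hβ']
  have hnW_nonneg : 0 ≤ nW := hnW ▸ Finset.sum_nonneg fun i _ => by positivity
  rcases hnW_nonneg.eq_or_lt with h0 | hpos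
  · -- `W = 0`, hence `β = 0`
    have hW : ∀ i, W i = 0 := by
      intro i
      have := (Finset.sum_eq_zero_iff_of_nonneg (fun i _ => by positivity)).1 (hnW.trans h0.symm)
        i (Finset.mem_univ _)
      simpa using this
    have hβ0 : β = 0 := by
      rw [← hβ]
      exact Finset.sum_eq_zero fun i _ => by simp [hW i]
    rw [hβ0, ← h0]
    simp
  · rw [le_div_iff₀ hpos]
    nlinarith [sq_nonneg (‖β‖ - nW), Complex.re_le_norm β, norm_nonneg β]

/-- Three unit vectors give a unit product vector: `Σ_{abc} ‖x a · y b · z c‖² = 1`. -/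
theorem sum_norm_sq_mul_mul_eq_one {α β γ : Type*} [Fintype α] [Fintype β] [Fintype γ]
    (x : α → ℂ) (y : β → ℂ) (z : γ → ℂ) (hx : ∑ i, ‖x i‖ ^ 2 = 1) (hy : ∑ i, ‖y i‖ ^ 2 = 1)
    (hz : ∑ i, ‖z i‖ ^ 2 = 1) : ∑ a, ∑ b, ∑ c, ‖x a * y b * z c‖ ^ 2 = 1 := by
  simp_rw [norm_mul, mul_pow, ← Finset.mul_sum, hz, mul_one, ← Finset.mul_sum, hy, mul_one, hx]

/-- A nonzero tensor has positive squared `ℓ²` norm `Σ_{abc} ‖S abc‖² > 0`. -/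
theorem sum_norm_sq_pos_of_ne_zero {α β γ : Type*} [Fintype α] [Fintype β] [Fintype γ]
    (S : α → β → γ → ℂ) (hS : S ≠ 0) : 0 < ∑ a, ∑ b, ∑ c, ‖S a b c‖ ^ 2 := by
  have hnn : 0 ≤ ∑ a, ∑ b, ∑ c, ‖S a b c‖ ^ 2 := Finset.sum_nonneg fun a _ =>
    Finset.sum_nonneg fun b _ => Finset.sum_nonneg fun c _ => by positivity
  rcases hnn.eq_or_lt with h | h
  · exfalso
    apply hS
    funext a b c
    have ha := (Finset.sum_eq_zero_iff_of_nonneg (fun a _ => Finset.sum_nonneg fun b _ =>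
      Finset.sum_nonneg fun c _ => by positivity)).1 h.symm a (Finset.mem_univ _)
    have hb := (Finset.sum_eq_zero_iff_of_nonneg (fun b _ =>
      Finset.sum_nonneg fun c _ => by positivity)).1 ha b (Finset.mem_univ _)
    have hc := (Finset.sum_eq_zero_iff_of_nonneg (fun c _ => by positivity)).1 hb c
      (Finset.mem_univ _)
    simpa using hc
  · exact h

/-! ## The two-plane Bessel step over one finite index -/

/-- **Two-plane Bessel step, flattened.** `S, T, u` complex vectors on one finite index, `T` real
(`conj T = T`), `‖S‖² > 0`, `‖u‖² = 1`; `k = conj (Σ S T) / ‖S‖²`, `e = Σ (T − k S) · u`.  Then with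
`S' := k S + e · conj u`: `|Σ S T|² / ‖S‖² + |e|² ≤ |Σ S' T|² / ‖S'‖²` (indeed
`‖T − S'‖² = ‖T‖² − |Σ S T|²/‖S‖² − |e|²`, then `sum_norm_sq_sub_le_div`). -/
theorem two_plane_step_flat {ι : Type*} [Fintype ι] (S T u : ι → ℂ) (hT : ∀ i, conj (T i) = T i)
    (hS : 0 < ∑ i, ‖S i‖ ^ 2) (hu : ∑ i, ‖u i‖ ^ 2 = 1) (k e : ℂ)
    (hk : k = conj (∑ i, S i * T i) / ((∑ i, ‖S i‖ ^ 2 : ℝ) : ℂ))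
    (he : e = ∑ i, (T i - k * S i) * u i) :
    ‖∑ i, S i * T i‖ ^ 2 / (∑ i, ‖S i‖ ^ 2) + ‖e‖ ^ 2 ≤
      ‖∑ i, (k * S i + e * conj (u i)) * T i‖ ^ 2 / ∑ i, ‖k * S i + e * conj (u i)‖ ^ 2 := by
  obtain ⟨ns, hns⟩ : ∃ ns : ℝ, (∑ i, ‖S i‖ ^ 2) = ns := ⟨_, rfl⟩
  obtain ⟨ov, hov⟩ : ∃ ov : ℂ, (∑ i, S i * T i) = ov := ⟨_, rfl⟩
  rw [hns, hov] at hk ⊢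
  rw [hns] at hS
  have hns0 : ns ≠ 0 := hS.ne'
  -- the pairing with the real vector `T` is conjugation-symmetric
  have hreal : ∀ W : ι → ℂ, (∑ i, conj (W i) * T i) = conj (∑ i, W i * T i) := fun W => by
    rw [map_sum]
    exact Finset.sum_congr rfl fun i _ => by rw [map_mul, hT]
  -- Bessel at `W := S'`
  have hB := sum_norm_sq_sub_le_div (fun i => k * S i + e * conj (u i)) T
  rw [hreal, Complex.norm_conj] at hB
  -- `‖T − S'‖² = ‖T‖² − fid S − |e|²`
  have hE : (∑ i, ‖T i - (k * S i + e * conj (u i))‖ ^ 2) =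
      (∑ i, ‖T i‖ ^ 2) - ‖ov‖ ^ 2 / ns - ‖e‖ ^ 2 := by
    have h1 : ∀ i, T i - (k * S i + e * conj (u i)) = (T i - k * S i) - e * conj (u i) :=
      fun i => by ring
    simp_rw [h1]
    rw [sum_norm_sub_sq, sum_norm_sub_sq]
    have h2 : (∑ i, ‖k * S i‖ ^ 2) = ‖ov‖ ^ 2 / ns := by
      simp_rw [norm_mul, mul_pow]
      rw [← Finset.mul_sum, hns, hk, norm_div, Complex.norm_conj, Complex.norm_real,
        Real.norm_of_nonneg hS.le]
      field_simp
    have h3 : (∑ i, T i * conj (k * S i)).re = ‖ov‖ ^ 2 / ns := by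
      have h3' : (∑ i, T i * conj (k * S i)) = conj k * conj ov := by
        rw [← hov, ← hreal, Finset.mul_sum]
        exact Finset.sum_congr rfl fun i _ => by rw [map_mul]; ring
      rw [h3', hk, map_div₀, Complex.conj_conj, Complex.conj_ofReal, div_mul_eq_mul_div,
        Complex.mul_conj', ← Complex.ofReal_pow, ← Complex.ofReal_div, Complex.ofReal_re]
    have h4 : (∑ i, ‖e * conj (u i)‖ ^ 2) = ‖e‖ ^ 2 := by
      simp_rw [norm_mul, mul_pow, Complex.norm_conj]
      rw [← Finset.mul_sum, hu, mul_one]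
    have h5 : (∑ i, (T i - k * S i) * conj (e * conj (u i))).re = ‖e‖ ^ 2 := by
      have h5' : (∑ i, (T i - k * S i) * conj (e * conj (u i))) = conj e * e := by
        calc (∑ i, (T i - k * S i) * conj (e * conj (u i)))
            = conj e * ∑ i, (T i - k * S i) * u i := by
              rw [Finset.mul_sum]
              exact Finset.sum_congr rfl fun i _ => by rw [map_mul, Complex.conj_conj]; ring
          _ = conj e * e := by rw [← he]
      rw [h5', Complex.conj_mul', ← Complex.ofReal_pow, Complex.ofReal_re]
    rw [h2, h3, h4, h5]
    ring
  rw [hE] at hB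
  linarith

/-! ## Transport to the three-slot format -/

/-- Entries of a rank-one update: `k • S + (e x̄) ⊗ ȳ ⊗ z̄` entrywise. -/
theorem smul_add_triad_apply {α β γ : Type*} (S : α → β → γ → ℂ) (x : α → ℂ) (y : β → ℂ)
    (z : γ → ℂ) (k e : ℂ) :
    (fun a b c => k * S a b c + e * (conj (x a) * conj (y b) * conj (z c))) =
      k • S + triad (fun a => e * conj (x a)) (fun b => conj (y b)) (fun c => conj (z c)) := by
  funext a b c
  simp only [Pi.add_apply, Pi.smul_apply, smul_eq_mul, triad_apply]
  ring

/-- A rank-one update of a rank-`≤ r` tensor has rank `≤ r + 1`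
(`tensorRank_add_le`, `tensorRank_smul_le`, a triad has rank `≤ 1`). -/
theorem tensorRank_smul_add_triad_le {α β γ : Type*} [Fintype α] [Fintype β] [Fintype γ]
    (r : ℕ) (S : α → β → γ → ℂ) (hr : tensorRank S ≤ r) (x : α → ℂ) (y : β → ℂ) (z : γ → ℂ)
    (k e : ℂ) :
    tensorRank (fun a b c => k * S a b c + e * (conj (x a) * conj (y b) * conj (z c))) ≤ r + 1 := by
  rw [smul_add_triad_apply]
  refine (tensorRank_add_le _ _).trans (add_le_add ((tensorRank_smul_le k S).trans hr) ?_)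
  exact tensorRank_le_of_eq_sum (fun _ : Fin 1 => fun a => e * conj (x a))
    (fun _ => fun b => conj (y b)) (fun _ => fun c => conj (z c)) (by simp)

/-- **Two-plane Bessel step, three-slot format, for any real tensor `T`.**  For `S ≠ 0` of rank
`≤ r`, unit vectors `x, y, z`, and `k := conj (Σ S T) / ‖S‖²`,
`e := Σ (T − k S) abc · x a · y b · z c`, the tensor `S' := k • S + e • (x̄ ⊗ ȳ ⊗ z̄)` has rank
`≤ r + 1` and `fid S + |e|² ≤ fid S'`. -/
theorem oneStepGain_of_conj_eq {α β γ : Type*} [Fintype α] [Fintype β] [Fintype γ] (r : ℕ)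
    (S T : α → β → γ → ℂ) (x : α → ℂ) (y : β → ℂ) (z : γ → ℂ)
    (hT : ∀ a b c, conj (T a b c) = T a b c) (hr : tensorRank S ≤ r) (hS : S ≠ 0)
    (hx : ∑ i, ‖x i‖ ^ 2 = 1) (hy : ∑ i, ‖y i‖ ^ 2 = 1) (hz : ∑ i, ‖z i‖ ^ 2 = 1) :
    ∃ S' : α → β → γ → ℂ, tensorRank S' ≤ r + 1 ∧
      ‖∑ a, ∑ b, ∑ c, S a b c * T a b c‖ ^ 2 / (∑ a, ∑ b, ∑ c, ‖S a b c‖ ^ 2) +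
          ‖∑ a, ∑ b, ∑ c, (T a b c -
              conj (∑ a', ∑ b', ∑ c', S a' b' c' * T a' b' c') /
                ((∑ a', ∑ b', ∑ c', ‖S a' b' c'‖ ^ 2 : ℝ) : ℂ) * S a b c) * x a * y b * z c‖ ^ 2 ≤
        ‖∑ a, ∑ b, ∑ c, S' a b c * T a b c‖ ^ 2 / (∑ a, ∑ b, ∑ c, ‖S' a b c‖ ^ 2) := by
  obtain ⟨k, hk⟩ : ∃ k : ℂ, k = conj (∑ a', ∑ b', ∑ c', S a' b' c' * T a' b' c') /
      ((∑ a', ∑ b', ∑ c', ‖S a' b' c'‖ ^ 2 : ℝ) : ℂ) := ⟨_, rfl⟩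
  obtain ⟨e, he⟩ : ∃ e : ℂ, e = ∑ a, ∑ b, ∑ c, (T a b c - k * S a b c) * x a * y b * z c :=
    ⟨_, rfl⟩
  refine ⟨fun a b c => k * S a b c + e * (conj (x a) * conj (y b) * conj (z c)),
    tensorRank_smul_add_triad_le r S hr x y z k e, ?_⟩
  rw [← hk, ← he]
  have h := two_plane_step_flat (fun p : α × β × γ => S p.1 p.2.1 p.2.2)
    (fun p => T p.1 p.2.1 p.2.2) (fun p => x p.1 * y p.2.1 * z p.2.2) (fun p => hT _ _ _)
    (by simpa only [Fintype.sum_prod_type] using sum_norm_sq_pos_of_ne_zero S hS)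
    (by simpa only [Fintype.sum_prod_type] using sum_norm_sq_mul_mul_eq_one x y z hx hy hz)
    k e (by simpa only [Fintype.sum_prod_type] using hk)
    (by rw [he]; simp only [Fintype.sum_prod_type, mul_assoc])
  simpa only [Fintype.sum_prod_type, map_mul] using h

/-! ## The stub -/

/-- The matrix multiplication tensor has real (`0/1`) entries:
`conj ⟨n,n,n⟩_{abc} = ⟨n,n,n⟩_{abc}`. -/
theorem conj_matMulTensor (n : ℕ) (a b c : Fin n × Fin n) :
    conj (matMulTensor ℂ n n n a b c) = matMulTensor ℂ n n n a b c := by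
  unfold matMulTensor
  split_ifs <;> simp

/-- stub `stub_oneStepGain` of line `border-singular-values` for crux `LinearDefectLaw`
(stmt-MatrixMultiplication-14039): two-plane Bessel step.  For `S ≠ 0` of rank `≤ r` in the
`⟨n,n,n⟩` format and unit vectors `x, y, z`, some tensor `S'` of rank `≤ r + 1` has fidelity
`|Σ S' T|² / ‖S'‖²` at least `fid S + |resid S (x,y,z)|²`, where
`resid S = T − (conj (Σ S T) / ‖S‖²) • S` is the residual of `T = ⟨n,n,n⟩` after projection onto
`ℂ • S` (take `S' := P_{ℂS} T + resid S (x,y,z) • (x̄ ⊗ ȳ ⊗ z̄)`; `oneStepGain_of_conj_eq`). -/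
theorem stub_oneStepGain :
    ∀ (n r : ℕ) (S : Fin n × Fin n → Fin n × Fin n → Fin n × Fin n → ℂ) (x y z : Fin n × Fin n → ℂ),
      tensorRank S ≤ r → S ≠ 0 →
      (∑ i, ‖x i‖ ^ 2) = 1 → (∑ i, ‖y i‖ ^ 2) = 1 → (∑ i, ‖z i‖ ^ 2) = 1 →
      ∃ S' : Fin n × Fin n → Fin n × Fin n → Fin n × Fin n → ℂ, tensorRank S' ≤ r + 1 ∧
        ‖∑ a, ∑ b, ∑ c, S a b c * matMulTensor ℂ n n n a b c‖ ^ 2 / (∑ a, ∑ b, ∑ c, ‖S a b c‖ ^ 2) +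
          ‖∑ a, ∑ b, ∑ c, (matMulTensor ℂ n n n a b c -
              (starRingEnd ℂ) (∑ a', ∑ b', ∑ c', S a' b' c' * matMulTensor ℂ n n n a' b' c') /
                ((∑ a', ∑ b', ∑ c', ‖S a' b' c'‖ ^ 2 : ℝ) : ℂ) * S a b c) * x a * y b * z c‖ ^ 2 ≤
        ‖∑ a, ∑ b, ∑ c, S' a b c * matMulTensor ℂ n n n a b c‖ ^ 2 / (∑ a, ∑ b, ∑ c, ‖S' a b c‖ ^ 2) :=
  fun n r S x y z hr hS hx hy hz =>
    oneStepGain_of_conj_eq r S (matMulTensor ℂ n n n) x y z (conj_matMulTensor n) hr hS hx hy hz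

end Summit.MatrixMultiplication.MatrixMultiplication.Theorems.LinearDefectLaw.OneStepGain
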